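import Literature.Analysis.FluidPDE.TimeDependentLinearFlow
import Literature.Analysis.FluidPDE.SuitableWeak
import HarnessLib

/-!
# The centred KNSS rate (R2) is a sufficient junk guard for forward rung blow-up letters — KJ-21

Negative-lane kernel (refuter lineage `ns-blowup-refuter`, g14; supports
`stmt-NavierStokesRegularity-19959`, crux `AngularGalerkinLadder.RungBlowupCofinal`).  No route file is
imported; nothing here asserts a Theses declaration.

CONTEXT.  KJ-18 (`RungBlowupCofinalForwardStubParasitic`, p475616) and KJ-20
(`RungBlowupCofinalLinearStrainParasitic`, p479287/p479890) exhibited the two energy-free exact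
families that junk-inhabit forward rung blow-up letters of the shape
`IsRungSolutionOn ∧ smooth decaying datum ∧ … ∧ ¬ bounded`: Galilean DRIFTS `u(t,x) = c(t)` (rung
`L ≥ 1`) and Craik–Criminale LINEAR STRAINS `u(t,x) = a(t) D x` (rung `L ≥ 2`).  DIRECTOR-NS g6 #6 ruled
that the replacement letters (bc5w `HalfTurnForwardBlowup` v3, birth skeleton v4) CONJOIN the centred
Koch–Nadirashvili–Seregin–Šverák space-time rate

  R2 :  `∃ C, ∀ t ∈ [0,T), ∀ x, ‖u t x‖ ≤ C / (‖x‖ + √(T − t))`,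

keeping the sup-norm Type-I clause.  This file is the kernel backing of that ruling:

* `isTypeIBlowup_of_knss` — R2 implies the sup-norm clause `IsTypeIBlowup u T` (so the kept clause is
  redundant but harmless), and forces `0 ≤ C` (`knss_const_nonneg`);
* `eq_zero_of_knss_const`, `not_knss_const` — a field constant in `x` on one slice obeys R2 only if it
  vanishes there: R2 excludes the whole KJ-18 drift family (any `c(t₀) ≠ 0`, `t₀ ∈ [0,T)`);
* `eq_zero_of_knss_clm`, `not_knss_linearFlow` — a field linear in `x` on one slice obeys R2 only if
  it vanishes there: R2 excludes the whole KJ-20 family `LinearFlow.velocity M 0` (any `M t₀ ≠ 0`),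
  in particular the witness `M t = (t/(1−t)) • diag(1,2,−3)` of
  `halfTurnClauses_without_typeI_parasitic`.

Together with `RungBlowupCofinalLinearStrainParasitic.knss_rescale` /
`hasTypeIDecay_of_tendsto` (R2 is inherited with the same constant by every blow-up rescaling and by
pointwise limits) this closes the refuter's account of R2: it kills both catalogued parasitic families
by itself and feeds the extraction stub the `HasTypeIDecay` of the tangent flow.  What R2 does NOT do is
recorded for the prover: it does not make the pressure gauge physical by itself (a harmonic `∇h(t)·x`
gauge is excluded only through the velocity it would drive), and it is a genuine restriction of the
BC5 witness class (centred Type-I in space-time, the KNSS class), not a normalisation.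
[cite: KochNadirashviliSereginSverak2009, (1.3) and Thm 1.1]
-/

open Set Filter
open scoped Topology

namespace Summit.NavierStokesRegularity.RungBlowupCofinalKnssGuard

open Literature.Analysis.FluidPDE

/-! ## §1 Sign of the constant; R2 implies the sup-norm Type-I clause -/

/-- A KNSS-type bound at a single point forces `0 ≤ C`. -/
theorem knss_const_nonneg {E : Type*} [NormedAddCommGroup E] {v : E} {C a : ℝ} (ha : 0 < a)
    (h : ‖v‖ ≤ C / a) : 0 ≤ C := by
  by_contra hC
  have : C / a < 0 := div_neg_of_neg_of_pos (lt_of_not_ge hC) ha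
  linarith [norm_nonneg v]

/-- **R2 ⇒ sup-norm Type-I.**  The centred KNSS rate on `[0,T) × E`, `0 < T`, implies
`IsTypeIBlowup u T` with the same constant. -/
theorem isTypeIBlowup_of_knss {E : Type*} [NormedAddCommGroup E] {u : ℝ → E → E} {T C : ℝ}
    (hT : 0 < T) (h : ∀ t ∈ Ico (0 : ℝ) T, ∀ x, ‖u t x‖ ≤ C / (‖x‖ + Real.sqrt (T - t))) :
    IsTypeIBlowup u T := by
  have hC : 0 ≤ C := by
    have h0 := h 0 ⟨le_rfl, hT⟩ 0
    rw [norm_zero, zero_add, sub_zero] at h0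
    exact knss_const_nonneg (Real.sqrt_pos.mpr hT) h0
  refine ⟨C, ?_⟩
  filter_upwards [Ico_mem_nhdsLT hT] with t ht x
  have hs : 0 < Real.sqrt (T - t) := Real.sqrt_pos.mpr (by linarith [ht.2])
  exact (h t ht x).trans
    (div_le_div_of_nonneg_left hC hs (le_add_of_nonneg_left (norm_nonneg x)))

/-! ## §2 R2 excludes slice-wise constant fields (the KJ-18 drift family) -/

/-- A vector `c` with `‖c‖ ≤ C / (‖x‖ + s)` for every `x` (`0 < s`) is zero. -/
theorem eq_zero_of_knss_const {E : Type*} [NormedAddCommGroup E] [NormedSpace ℝ E] {c : E}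
    {C s : ℝ} (hs : 0 < s) (h : ∀ x : E, ‖c‖ ≤ C / (‖x‖ + s)) : c = 0 := by
  by_contra hc
  have hcpos : 0 < ‖c‖ := norm_pos_iff.mpr hc
  set r : ℝ := (|C| + 1) / ‖c‖ ^ 2 with hr_def
  have hr : 0 ≤ r := by positivity
  have hx : ‖r • c‖ = (|C| + 1) / ‖c‖ := by
    rw [norm_smul, Real.norm_of_nonneg hr, hr_def]
    field_simp
  have h1 := h (r • c)
  rw [hx, le_div_iff₀ (by positivity)] at h1
  have h2 : ‖c‖ * ((|C| + 1) / ‖c‖ + s) = |C| + 1 + ‖c‖ * s := by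
    field_simp
  rw [h2] at h1
  nlinarith [le_abs_self C, mul_pos hcpos hs]

/-- **R2 excludes drifts.**  If some slice `u t₀`, `t₀ ∈ [0,T)`, is a non-zero constant field, the
centred KNSS rate fails for every constant `C` — the KJ-18 family
(`RungBlowupCofinalForwardStubParasitic.rungForwardTypeIBlowup_parasitic`, drift velocity `c(t)` with
`c(t₀) ≠ 0`) is outside every R2-guarded letter. -/
theorem not_knss_const {E : Type*} [NormedAddCommGroup E] [NormedSpace ℝ E] {u : ℝ → E → E}
    {T t₀ : ℝ} (ht₀ : t₀ ∈ Ico (0 : ℝ) T) {c : E} (hc : c ≠ 0) (hu : ∀ x, u t₀ x = c) (C : ℝ) :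
    ¬ ∀ t ∈ Ico (0 : ℝ) T, ∀ x, ‖u t x‖ ≤ C / (‖x‖ + Real.sqrt (T - t)) := by
  intro h
  refine hc (eq_zero_of_knss_const (C := C)
    (Real.sqrt_pos.mpr (by linarith [ht₀.2] : 0 < T - t₀)) fun x => ?_)
  rw [← hu x]
  exact h t₀ ht₀ x

/-! ## §3 R2 excludes slice-wise linear fields (the KJ-20 linear-strain family) -/

/-- A continuous linear map `A` with `‖A x‖ ≤ C / (‖x‖ + s)` for every `x` (`0 < s`) is zero. -/
theorem eq_zero_of_knss_clm {E : Type*} [NormedAddCommGroup E] [NormedSpace ℝ E] {A : E →L[ℝ] E}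
    {C s : ℝ} (hs : 0 < s) (h : ∀ x : E, ‖A x‖ ≤ C / (‖x‖ + s)) : A = 0 := by
  by_contra hA
  obtain ⟨x₀, hx₀⟩ : ∃ x, A x ≠ 0 := by
    by_contra h'
    exact hA (ContinuousLinearMap.ext fun x => by
      simpa using not_not.mp (not_exists.mp h' x))
  have hC : 0 ≤ C := by
    have h0 := h 0
    rw [norm_zero, zero_add] at h0
    exact knss_const_nonneg hs (v := A 0) h0
  have hpos : 0 < ‖A x₀‖ := norm_pos_iff.mpr hx₀
  have key : ∀ r : ℝ, 0 < r → r * ‖A x₀‖ ≤ C / s := fun r hr => by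
    have h1 := h (r • x₀)
    rw [map_smul, norm_smul, Real.norm_of_nonneg hr.le] at h1
    exact h1.trans (div_le_div_of_nonneg_left hC hs (le_add_of_nonneg_left (norm_nonneg _)))
  have hr : 0 < (C / s + 1) / ‖A x₀‖ := div_pos (by linarith [div_nonneg hC hs.le]) hpos
  have h2 := key _ hr
  rw [div_mul_cancel₀ _ hpos.ne'] at h2
  linarith

/-- **R2 excludes linear flows.**  A time-dependent linear flow `LinearFlow.velocity M 0`
(`u(t,x) = M(t) x`) with `M t₀ ≠ 0` at some `t₀ ∈ [0,T)` violates the centred KNSS rate for every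
constant `C` — the KJ-20 family (`RungBlowupCofinalLinearStrainParasitic.isRungSolutionOn_linearStrain`,
`M t = a(t) • D`; the witness of `halfTurnClauses_without_typeI_parasitic` has `M (1/2) = D ≠ 0`) is
outside every R2-guarded letter. -/
theorem not_knss_linearFlow {E : Type*} [NormedAddCommGroup E] [InnerProductSpace ℝ E]
    {M : ℝ → E →L[ℝ] E} {T t₀ : ℝ} (ht₀ : t₀ ∈ Ico (0 : ℝ) T) (hM : M t₀ ≠ 0) (C : ℝ) :
    ¬ ∀ t ∈ Ico (0 : ℝ) T, ∀ x, ‖LinearFlow.velocity M 0 t x‖ ≤ C / (‖x‖ + Real.sqrt (T - t)) := by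
  intro h
  refine hM (eq_zero_of_knss_clm (C := C)
    (Real.sqrt_pos.mpr (by linarith [ht₀.2] : 0 < T - t₀)) fun x => ?_)
  have h1 := h t₀ ht₀ x
  simpa [LinearFlow.velocity] using h1

/-- **R2 excludes affine flows altogether.**  `LinearFlow.velocity M b` (`u(t,x) = M(t) x + b(t)`)
obeys the centred KNSS rate on `[0,T)` only if `M t = 0` and `b t = 0` for every `t ∈ [0,T)` — i.e.
only the zero field of the whole time-dependent-linear-flow class passes an R2-guarded letter. -/
theorem linearFlow_eq_zero_of_knss {E : Type*} [NormedAddCommGroup E] [InnerProductSpace ℝ E]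
    {M : ℝ → E →L[ℝ] E} {b : ℝ → E} {T C : ℝ}
    (h : ∀ t ∈ Ico (0 : ℝ) T, ∀ x, ‖LinearFlow.velocity M b t x‖ ≤ C / (‖x‖ + Real.sqrt (T - t)))
    {t : ℝ} (ht : t ∈ Ico (0 : ℝ) T) : M t = 0 ∧ b t = 0 := by
  have hs : 0 < Real.sqrt (T - t) := Real.sqrt_pos.mpr (by linarith [ht.2])
  have hC : 0 ≤ C := by
    have h0 := h t ht 0
    rw [norm_zero, zero_add] at h0
    exact knss_const_nonneg hs h0
  -- the linear part: `M t x = (u(x) - u(-x)) / 2`, each term KNSS-bounded with the same denominator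
  have hM : M t = 0 := by
    refine eq_zero_of_knss_clm (C := C) hs fun x => ?_
    have h1 := h t ht x
    have h2 := h t ht (-x)
    simp only [LinearFlow.velocity, map_neg, norm_neg] at h1 h2
    have h3 : (M t) x = (1 / 2 : ℝ) • ((M t x + b t) - (-(M t) x + b t)) := by
      rw [show (M t x + b t) - (-(M t) x + b t) = (2 : ℝ) • (M t) x by
        rw [two_smul]; abel]
      rw [smul_smul]; norm_num
    rw [h3, norm_smul, show ‖(1 / 2 : ℝ)‖ = 1 / 2 by norm_num]
    have h4 : ‖(M t x + b t) - (-(M t) x + b t)‖ ≤ 2 * (C / (‖x‖ + Real.sqrt (T - t))) :=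
      (norm_sub_le _ _).trans (by linarith)
    linarith
  refine ⟨hM, ?_⟩
  refine eq_zero_of_knss_const (C := C) hs fun x => ?_
  have h1 := h t ht x
  simpa [LinearFlow.velocity, hM] using h1

end Summit.NavierStokesRegularity.RungBlowupCofinalKnssGuard
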